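/-
Copyright (c) 2026 the pub-hodgecm-mathlib formalisation cell (harness21).  Prover seat hodgecm-mathlib-K2E5-p10 (g2),
Track B «K2-LIT» ∕ h413 (stmt-HodgeConjecture-24833), engine E5 «TamagawaUnitary», unit G cert §6 organ:
THE PRODUCT FORMULA WITH A FINITE SET OF FINITE PLACES, in the `‖ι_v x‖` currency of ★ Gvol and with real powers (Step 6 of the comparison).  2026-09-04.
-/
import Mathlib.NumberTheory.NumberField.ProductFormula
import Mathlib.NumberTheory.NumberField.InfinitePlace.TotallyRealComplex
import Mathlib.Analysis.SpecialFunctions.Pow.NNReal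
import Literature.NumberTheory.Automorphic.AdelicAffineTwistHeightSum   -- ★ `mult_eq_one_of_isTotallyReal` (reused, not restated)
import HarnessLib

/-!
# K2_E5 road (h413 = stmt-HodgeConjecture-24833), unit G cert §6 organ: the product formula over a finite bad set

Cell `pub/hodgecm-mathlib` (D-0151), Track B; free-hand organ offered to dealer K2E5-plan (g2) on `K2/STATUS.md` (2026-09-04T00:2xZ) for cert §6 `G0D_of_sigs`
(SIGS TABLE ED.6 §2 ∕ SPEC `Lines/K2_E5_TamagawaUnitary_Zeta_ED3_SPEC.md` §1 Step 6: «`V(h)/V(h′) = ∏_{all v} |det Gram_h(e_h)/det Gram_{h′}(e_{h′})|_v^{1/2} = 1` (★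
`K2E5QuatGramNondegenerate`: determinants in `L⁺ˣ`; Mathlib product formula for number fields)»).  The bad∕arch normalisations of the two zeta functions are
`a_i · B_i = (common) · ∏_{w ∣ ∞} |d_i|_w^{1/2} · ∏_{v ∈ S} ‖ι_v d_i‖^{1/2}` with `d_i = det Gram_{h_i}(e_i) ∈ L⁺ˣ` and `S` a finite set of finite places containing every place
where `d_1` or `d_2` is not a unit; ★ G14's hypothesis `a₁ · B₁ = a₂ · B₂` is therefore exactly the product formula RESTRICTED TO `S`, at exponent `1/2`.

Mathlib's `NumberField.prod_abs_eq_one` is `(∏_{w ∣ ∞} w x ^ mult w) · ∏ᶠ_{w finite place} w x = 1` with a `finprod` over `FinitePlace K`; this file re-packages it: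

* §1 `norm_algebraMap_adicCompletion : ‖algebraMap K (v.adicCompletion K) x‖ = FinitePlace.mk v x` (the `‖ι_v x‖` currency of ★ Gvol `trdVol_quatLocalCoordLattice`),
  `exists_finset_norm_ne_one` (a finite set of `HeightOneSpectrum` places outside which `‖ι_v x‖ = 1`);
* §2 **`prod_infinitePlace_mul_prod_finitePlace_eq_one`** (`FinitePlace`-indexed finite set `S ⊇ {w : w x ≠ 1}`) and
  **`prod_infinitePlace_mul_prod_norm_eq_one`**: `(∏_{w ∣ ∞} w x ^ mult w) · ∏_{v ∈ S} ‖ι_v x‖ = 1` for every finite `S : Finset (HeightOneSpectrum (𝓞 K))` containing the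
  places with `‖ι_v x‖ ≠ 1` — enlarging `S` is free;
* §3 real powers: **`prod_rpow_infinitePlace_mul_prod_rpow_norm_eq_one`** (`… ^ r`, any real `r`, e.g. `r = 1/2`) and the two-element comparison form
  **`prod_rpow_eq_prod_rpow_of_superset`** (`x, y ≠ 0`, `S ⊇` both supports ⇒ the `S`-restricted products of `x` and `y` AGREE — ★ G14's `hab`);
* §4 the TOTALLY REAL base (`L⁺` is totally real): `mult w = 1` everywhere (★ `Literature.NumberTheory.Automorphic.mult_eq_one_of_isTotallyReal`), `prod_infinitePlace_mul_prod_norm_eq_one_of_isTotallyReal` (`∏_{w ∣ ∞} w x · ∏_{v∈S} ‖ι_v x‖ = 1`)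
  and its `^ r` form, and ★ Gvol's verbatim `NNReal.sqrt ‖·‖₊` comparison form `prod_sqrt_eq_prod_sqrt_of_superset_of_isTotallyReal`.

[cite: CasselsFrohlichANT1967, Ch. II §12 (product formula)] [cite: NeukirchANT1999, Ch. III §1 Prop. 1.3] [folklore]

HONEST LABEL: HC_CM is proved only modulo the 7 printed citations (2 remaining named inputs: hLiu418 = stmt-HodgeConjecture-24832,
h413 = stmt-HodgeConjecture-24833) until rung 0 closes; this file is a `--supports stmt-HodgeConjecture-24833 --as helper` leaf and retires nothing by itself.
-/

set_option autoImplicit false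
set_option linter.dupNamespace false   -- `Summit.HodgeConjecture.HodgeConjecture.…` (D-0017 nested layout; lakefile exemption for Summits)

noncomputable section

namespace Summit.HodgeConjecture.HodgeConjecture.Cruxes.H413.K2E5ProductFormulaFiniteSupport

open NumberField NumberField.InfinitePlace NumberField.FinitePlace IsDedekindDomain

variable (K : Type) [Field K] [NumberField K]   -- `Type` (not `Type*`): the ★ totally-real lemma is universe-0, as are all consumers (`L⁺`)

/-! ## §1 The `‖ι_v x‖` currency and the finite bad set -/

/-- `‖ι_v x‖ = (FinitePlace.mk v) x`: the norm in the `v`-adic completion of the image of `x ∈ K` under `algebraMap` IS Mathlib's finite place at `v`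
(`FinitePlace.mk_apply`, `algebraMap_adicCompletion`). [folklore] -/
theorem norm_algebraMap_adicCompletion (v : HeightOneSpectrum (𝓞 K)) (x : K) :
    ‖algebraMap K (v.adicCompletion K) x‖ = FinitePlace.mk v x := by
  rw [FinitePlace.mk_apply, FinitePlace.embedding_apply, HeightOneSpectrum.algebraMap_adicCompletion]
  rfl

/-- `‖ι_v x‖ ≤ 1` for an algebraic INTEGER `x` at every finite place. [cite: CasselsFrohlichANT1967, Ch. II §12] -/
theorem norm_algebraMap_adicCompletion_le_one (v : HeightOneSpectrum (𝓞 K)) (x : 𝓞 K) :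
    ‖algebraMap K (v.adicCompletion K) (x : K)‖ ≤ 1 := by
  rw [norm_algebraMap_adicCompletion, FinitePlace.mk_apply]
  exact FinitePlace.norm_le_one K v x

/-- **The bad set is finite**: for `x ≠ 0` there is a finite set `S` of finite places of `K` outside which `‖ι_v x‖ = 1` (Mathlib `FinitePlace.hasFiniteMulSupport`, reindexed
by `FinitePlace.equivHeightOneSpectrum`). [cite: CasselsFrohlichANT1967, Ch. II §12] -/
theorem exists_finset_norm_ne_one {x : K} (hx : x ≠ 0) :
    ∃ S : Finset (HeightOneSpectrum (𝓞 K)), ∀ v : HeightOneSpectrum (𝓞 K), ‖algebraMap K (v.adicCompletion K) x‖ ≠ 1 → v ∈ S := by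
  have hfin : (Function.mulSupport fun w : FinitePlace K => w x).Finite := FinitePlace.hasFiniteMulSupport hx
  refine ⟨hfin.toFinset.map FinitePlace.equivHeightOneSpectrum.toEmbedding, fun v hv => ?_⟩
  rw [Finset.mem_map]
  refine ⟨FinitePlace.mk v, ?_, FinitePlace.maximalIdeal_mk v⟩
  rw [Set.Finite.mem_toFinset, Function.mem_mulSupport, ← norm_algebraMap_adicCompletion]
  exact hv

/-! ## §2 The product formula with a finite set of finite places -/

/-- The finite part of the product formula as a FINITE product: if `S ⊇ {w : w x ≠ 1}` then `∏ᶠ_w w x = ∏_{w ∈ S} w x`. [folklore] -/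
theorem finprod_finitePlace_eq_prod {x : K} (S : Finset (FinitePlace K)) (hS : ∀ w : FinitePlace K, w x ≠ 1 → w ∈ S) :
    ∏ᶠ w : FinitePlace K, w x = ∏ w ∈ S, w x :=
  finprod_eq_prod_of_mulSupport_subset _ fun w hw => Finset.mem_coe.2 (hS w hw)

/-- **PRODUCT FORMULA, `FinitePlace`-indexed finite set**: `(∏_{w ∣ ∞} w x ^ mult w) · ∏_{w ∈ S} w x = 1` for `x ≠ 0` and any finite `S ⊇ {w : w x ≠ 1}`.
[cite: CasselsFrohlichANT1967, Ch. II §12] [cite: NeukirchANT1999, Ch. III §1 Prop. 1.3] -/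
theorem prod_infinitePlace_mul_prod_finitePlace_eq_one {x : K} (hx : x ≠ 0) (S : Finset (FinitePlace K))
    (hS : ∀ w : FinitePlace K, w x ≠ 1 → w ∈ S) :
    (∏ w : InfinitePlace K, w x ^ w.mult) * ∏ w ∈ S, w x = 1 := by
  rw [← finprod_finitePlace_eq_prod K S hS]
  exact NumberField.prod_abs_eq_one hx

/-- **PRODUCT FORMULA, `HeightOneSpectrum`-indexed finite set, `‖ι_v x‖` currency**: `(∏_{w ∣ ∞} w x ^ mult w) · ∏_{v ∈ S} ‖ι_v x‖ = 1` for `x ≠ 0` and every finite set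
`S` of finite places containing those with `‖ι_v x‖ ≠ 1` (any larger `S` — e.g. the bad set of cert §6 — is allowed). [cite: CasselsFrohlichANT1967, Ch. II §12] -/
theorem prod_infinitePlace_mul_prod_norm_eq_one {x : K} (hx : x ≠ 0) (S : Finset (HeightOneSpectrum (𝓞 K)))
    (hS : ∀ v : HeightOneSpectrum (𝓞 K), ‖algebraMap K (v.adicCompletion K) x‖ ≠ 1 → v ∈ S) :
    (∏ w : InfinitePlace K, w x ^ w.mult) * ∏ v ∈ S, ‖algebraMap K (v.adicCompletion K) x‖ = 1 := by
  have hS' : ∀ w : FinitePlace K, w x ≠ 1 → w ∈ S.map FinitePlace.equivHeightOneSpectrum.symm.toEmbedding := fun w hw => by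
    rw [Finset.mem_map]
    refine ⟨FinitePlace.maximalIdeal w, hS _ ?_, FinitePlace.mk_maximalIdeal w⟩
    rwa [norm_algebraMap_adicCompletion, FinitePlace.mk_maximalIdeal]
  have key := prod_infinitePlace_mul_prod_finitePlace_eq_one K hx _ hS'
  rw [Finset.prod_map] at key
  have hre : ∀ v ∈ S, (FinitePlace.equivHeightOneSpectrum.symm.toEmbedding v : FinitePlace K) x = ‖algebraMap K (v.adicCompletion K) x‖ :=
    fun v _ => (norm_algebraMap_adicCompletion K v x).symm
  rwa [Finset.prod_congr rfl hre] at key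

/-- The archimedean factor is positive. [folklore] -/
theorem prod_infinitePlace_pos {x : K} (hx : x ≠ 0) : 0 < ∏ w : InfinitePlace K, w x ^ w.mult :=
  Finset.prod_pos fun w _ => pow_pos ((map_ne_zero w).2 hx |> (AbsoluteValue.nonneg _ _).lt_of_ne') _

/-- The finite factor over `S` is positive. [folklore] -/
theorem prod_norm_pos {x : K} (hx : x ≠ 0) (S : Finset (HeightOneSpectrum (𝓞 K))) :
    0 < ∏ v ∈ S, ‖algebraMap K (v.adicCompletion K) x‖ :=
  Finset.prod_pos fun _ _ => norm_pos_iff.2 ((map_ne_zero _).2 hx)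

/-! ## §3 Real powers (cert §6 uses the exponent `1/2`) and the two-element comparison -/

/-- **PRODUCT FORMULA AT A REAL EXPONENT**: `(∏_{w ∣ ∞} (w x ^ mult w) ^ r) · ∏_{v ∈ S} ‖ι_v x‖ ^ r = 1` (`x ≠ 0`, `S ⊇` the bad set, any real `r`; `r = 1/2` in cert §6).
[cite: CasselsFrohlichANT1967, Ch. II §12] -/
theorem prod_rpow_infinitePlace_mul_prod_rpow_norm_eq_one {x : K} (hx : x ≠ 0) (S : Finset (HeightOneSpectrum (𝓞 K)))
    (hS : ∀ v : HeightOneSpectrum (𝓞 K), ‖algebraMap K (v.adicCompletion K) x‖ ≠ 1 → v ∈ S) (r : ℝ) :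
    (∏ w : InfinitePlace K, (w x ^ w.mult) ^ r) * ∏ v ∈ S, ‖algebraMap K (v.adicCompletion K) x‖ ^ r = 1 := by
  have hA : (∏ w : InfinitePlace K, (w x ^ w.mult) ^ r) = (∏ w : InfinitePlace K, w x ^ w.mult) ^ r :=
    Real.finsetProd_rpow Finset.univ (fun w : InfinitePlace K => w x ^ w.mult) (fun w _ => pow_nonneg (AbsoluteValue.nonneg _ _) _) r
  have hB : (∏ v ∈ S, ‖algebraMap K (v.adicCompletion K) x‖ ^ r) = (∏ v ∈ S, ‖algebraMap K (v.adicCompletion K) x‖) ^ r :=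
    Real.finsetProd_rpow S (fun v => ‖algebraMap K (v.adicCompletion K) x‖) (fun v _ => norm_nonneg _) r
  rw [hA, hB, ← Real.mul_rpow (prod_infinitePlace_pos K hx).le (prod_norm_pos K hx S).le,
    prod_infinitePlace_mul_prod_norm_eq_one K hx S hS, Real.one_rpow]

/-- **THE COMPARISON FORM (★ G14's `hab`)**: for `x, y ≠ 0` and a finite `S` containing the bad places of BOTH, the `S`-restricted products agree:
`(∏_{w∣∞} (w x ^ mult w) ^ r) · ∏_{v∈S} ‖ι_v x‖ ^ r = (∏_{w∣∞} (w y ^ mult w) ^ r) · ∏_{v∈S} ‖ι_v y‖ ^ r` (both equal `1`). [cite: CasselsFrohlichANT1967, Ch. II §12] -/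
theorem prod_rpow_eq_prod_rpow_of_superset {x y : K} (hx : x ≠ 0) (hy : y ≠ 0) (S : Finset (HeightOneSpectrum (𝓞 K)))
    (hSx : ∀ v : HeightOneSpectrum (𝓞 K), ‖algebraMap K (v.adicCompletion K) x‖ ≠ 1 → v ∈ S)
    (hSy : ∀ v : HeightOneSpectrum (𝓞 K), ‖algebraMap K (v.adicCompletion K) y‖ ≠ 1 → v ∈ S) (r : ℝ) :
    (∏ w : InfinitePlace K, (w x ^ w.mult) ^ r) * ∏ v ∈ S, ‖algebraMap K (v.adicCompletion K) x‖ ^ r =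
      (∏ w : InfinitePlace K, (w y ^ w.mult) ^ r) * ∏ v ∈ S, ‖algebraMap K (v.adicCompletion K) y‖ ^ r := by
  rw [prod_rpow_infinitePlace_mul_prod_rpow_norm_eq_one K hx S hSx r, prod_rpow_infinitePlace_mul_prod_rpow_norm_eq_one K hy S hSy r]

/-- Multiplying a COMMON factor: `c · A(x) · B_S(x) = c · A(y) · B_S(y)` in the situation of `prod_rpow_eq_prod_rpow_of_superset` — the literal shape of ★ G14's
`a₁ * B₁ = a₂ * B₂` after `a_i = c_∞ · A(d_i)`, `B_i = c_S · B_S(d_i)`. [folklore] -/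
theorem mul_prod_rpow_eq_of_superset {x y : K} (hx : x ≠ 0) (hy : y ≠ 0) (S : Finset (HeightOneSpectrum (𝓞 K)))
    (hSx : ∀ v : HeightOneSpectrum (𝓞 K), ‖algebraMap K (v.adicCompletion K) x‖ ≠ 1 → v ∈ S)
    (hSy : ∀ v : HeightOneSpectrum (𝓞 K), ‖algebraMap K (v.adicCompletion K) y‖ ≠ 1 → v ∈ S) (r : ℝ) (c c' : ℝ) :
    (c * ∏ w : InfinitePlace K, (w x ^ w.mult) ^ r) * (c' * ∏ v ∈ S, ‖algebraMap K (v.adicCompletion K) x‖ ^ r) =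
      (c * ∏ w : InfinitePlace K, (w y ^ w.mult) ^ r) * (c' * ∏ v ∈ S, ‖algebraMap K (v.adicCompletion K) y‖ ^ r) := by
  have h := prod_rpow_eq_prod_rpow_of_superset K hx hy S hSx hSy r
  calc (c * ∏ w : InfinitePlace K, (w x ^ w.mult) ^ r) * (c' * ∏ v ∈ S, ‖algebraMap K (v.adicCompletion K) x‖ ^ r)
      = c * c' * ((∏ w : InfinitePlace K, (w x ^ w.mult) ^ r) * ∏ v ∈ S, ‖algebraMap K (v.adicCompletion K) x‖ ^ r) := by ring
    _ = c * c' * ((∏ w : InfinitePlace K, (w y ^ w.mult) ^ r) * ∏ v ∈ S, ‖algebraMap K (v.adicCompletion K) y‖ ^ r) := by rw [h]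
    _ = (c * ∏ w : InfinitePlace K, (w y ^ w.mult) ^ r) * (c' * ∏ v ∈ S, ‖algebraMap K (v.adicCompletion K) y‖ ^ r) := by ring

/-! ## §4 Totally real base field (`L⁺`): every infinite place is real, `mult w = 1` -/

/-- **PRODUCT FORMULA OVER A TOTALLY REAL FIELD with a finite bad set**: `(∏_{w ∣ ∞} w x) · ∏_{v ∈ S} ‖ι_v x‖ = 1`. [cite: CasselsFrohlichANT1967, Ch. II §12] -/
theorem prod_infinitePlace_mul_prod_norm_eq_one_of_isTotallyReal [IsTotallyReal K] {x : K} (hx : x ≠ 0)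
    (S : Finset (HeightOneSpectrum (𝓞 K))) (hS : ∀ v : HeightOneSpectrum (𝓞 K), ‖algebraMap K (v.adicCompletion K) x‖ ≠ 1 → v ∈ S) :
    (∏ w : InfinitePlace K, w x) * ∏ v ∈ S, ‖algebraMap K (v.adicCompletion K) x‖ = 1 := by
  have key := prod_infinitePlace_mul_prod_norm_eq_one K hx S hS
  rwa [Finset.prod_congr rfl fun w _ => by rw [Literature.NumberTheory.Automorphic.mult_eq_one_of_isTotallyReal K w, pow_one]] at key

/-- The same at a real exponent: `(∏_{w ∣ ∞} (w x) ^ r) · ∏_{v ∈ S} ‖ι_v x‖ ^ r = 1` over a totally real field. [cite: CasselsFrohlichANT1967, Ch. II §12] -/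
theorem prod_rpow_infinitePlace_mul_prod_rpow_norm_eq_one_of_isTotallyReal [IsTotallyReal K] {x : K} (hx : x ≠ 0)
    (S : Finset (HeightOneSpectrum (𝓞 K))) (hS : ∀ v : HeightOneSpectrum (𝓞 K), ‖algebraMap K (v.adicCompletion K) x‖ ≠ 1 → v ∈ S) (r : ℝ) :
    (∏ w : InfinitePlace K, (w x) ^ r) * ∏ v ∈ S, ‖algebraMap K (v.adicCompletion K) x‖ ^ r = 1 := by
  have key := prod_rpow_infinitePlace_mul_prod_rpow_norm_eq_one K hx S hS r
  rwa [Finset.prod_congr rfl fun w _ => by rw [Literature.NumberTheory.Automorphic.mult_eq_one_of_isTotallyReal K w, pow_one]] at key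

/-- Totally real comparison form: `(∏_{w∣∞} (w x)^r) · ∏_{v∈S} ‖ι_v x‖^r = (∏_{w∣∞} (w y)^r) · ∏_{v∈S} ‖ι_v y‖^r` for `S ⊇` both bad sets. [cite: CasselsFrohlichANT1967, Ch. II §12] -/
theorem prod_rpow_eq_prod_rpow_of_superset_of_isTotallyReal [IsTotallyReal K] {x y : K} (hx : x ≠ 0) (hy : y ≠ 0)
    (S : Finset (HeightOneSpectrum (𝓞 K)))
    (hSx : ∀ v : HeightOneSpectrum (𝓞 K), ‖algebraMap K (v.adicCompletion K) x‖ ≠ 1 → v ∈ S)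
    (hSy : ∀ v : HeightOneSpectrum (𝓞 K), ‖algebraMap K (v.adicCompletion K) y‖ ≠ 1 → v ∈ S) (r : ℝ) :
    (∏ w : InfinitePlace K, (w x) ^ r) * ∏ v ∈ S, ‖algebraMap K (v.adicCompletion K) x‖ ^ r =
      (∏ w : InfinitePlace K, (w y) ^ r) * ∏ v ∈ S, ‖algebraMap K (v.adicCompletion K) y‖ ^ r := by
  rw [prod_rpow_infinitePlace_mul_prod_rpow_norm_eq_one_of_isTotallyReal K hx S hSx r,
    prod_rpow_infinitePlace_mul_prod_rpow_norm_eq_one_of_isTotallyReal K hy S hSy r]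

/-- **★ Gvol's VERBATIM currency** (`NNReal.sqrt ‖ι_v d‖₊`, ★ `trdVol_quatLocalCoordLattice`) over a totally real field: for `x, y ≠ 0` and `S ⊇` both bad sets,
`(∏_{w∣∞} √(w x)) · ∏_{v∈S} √‖ι_v x‖₊ = (∏_{w∣∞} √(w y)) · ∏_{v∈S} √‖ι_v y‖₊` (read in `ℝ`). [cite: CasselsFrohlichANT1967, Ch. II §12] -/
theorem prod_sqrt_eq_prod_sqrt_of_superset_of_isTotallyReal [IsTotallyReal K] {x y : K} (hx : x ≠ 0) (hy : y ≠ 0)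
    (S : Finset (HeightOneSpectrum (𝓞 K)))
    (hSx : ∀ v : HeightOneSpectrum (𝓞 K), ‖algebraMap K (v.adicCompletion K) x‖ ≠ 1 → v ∈ S)
    (hSy : ∀ v : HeightOneSpectrum (𝓞 K), ‖algebraMap K (v.adicCompletion K) y‖ ≠ 1 → v ∈ S) :
    (∏ w : InfinitePlace K, Real.sqrt (w x)) * ∏ v ∈ S, ((NNReal.sqrt ‖algebraMap K (v.adicCompletion K) x‖₊ : NNReal) : ℝ) =
      (∏ w : InfinitePlace K, Real.sqrt (w y)) * ∏ v ∈ S, ((NNReal.sqrt ‖algebraMap K (v.adicCompletion K) y‖₊ : NNReal) : ℝ) := by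
  have key := prod_rpow_eq_prod_rpow_of_superset_of_isTotallyReal K hx hy S hSx hSy (1 / 2 : ℝ)
  simp only [Real.coe_sqrt, coe_nnnorm, Real.sqrt_eq_rpow]
  exact key

end Summit.HodgeConjecture.HodgeConjecture.Cruxes.H413.K2E5ProductFormulaFiniteSupport

end
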